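import Literature.NumberTheory.GaloisRepresentations.LabelledHodgeTateWeights
import Mathlib.LinearAlgebra.Dimension.Finrank
import HarnessLib

/-!
# Transport of label components `D_τ` and their filtrations along `Φ ⊗ 1`

Topic `NumberTheory/GaloisRepresentations`; theorems only (no definition, no named fact).
Companion of the accepted `AdmissibleRestrictOfRingEquiv` (which transports `D_B(V)` and
admissibility along an equivariant ring isomorphism of period rings) for the COEFFICIENT
formalism of `LabelledHodgeTateWeights`: `V ⊗_P B` with `E` acting on `V`, the diagonal action
`PeriodRingData.coeffTensorRep`, the label components `PeriodRingData.labelD` and the filtration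
pieces `PeriodRingData.coeffFilTensor`, `PeriodRingData.labelFilD`.

Let `𝔅₁ = (B₁, Γ₁, F₁)`, `𝔅₂ = (B₂, Γ₂, F₂)` be period-ring data over `P`, `ρ₁`, `ρ₂` continuous
`E`-linear representations of `Γ₁`, `Γ₂` on `V = M` with `ρ₂ τ = ρ₁ (r τ)` for a map `r : Γ₂ → Γ₁`,
and `Φ : B₁ ≃+* B₂` a ring isomorphism which is `P`-linear, `r`-equivariant and strictly filtered
(`b ∈ Fil^i B₁ ↔ Φ b ∈ Fil^i B₂`).  Then `Ψ = 1 ⊗ Φ : V ⊗_P B₁ ≃ V ⊗_P B₂` (`E`-linear)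
intertwines the diagonal actions through `r`, the multiplications by `b` and `Φ b`, and the
filtration pieces, so that for every label `τ₂ : F₂ → E`

  `Fil^i D_{τ₂}(ρ₂) = Ψ( {y ∈ (V ⊗ B₁) | r(Γ₂)-invariant, Φ⁻¹(F₂) acts through τ₂} ∩ (V ⊗ Fil^i B₁) )`,

whence the equality of `E`-dimensions `finrank_labelFilD_eq_finrank_inf` (the right-hand side
subspace is supplied by the caller through its membership condition).  With `B₁ = B_dR(K)`,
`B₂ = B_dR(L)`, `r = res_{L/K}` this reduces `HT_{τ''}(ρ|_{Γ_L})` to a label-component computation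
inside `V ⊗ B_dR(K)` (file `PAdicHodge/LabelledHodgeTateWeightsBaseChangeProofs`).  Also: the
multiplication action `b ↦ 1 ⊗ (b · )` of a ring mapping to `B` as a ring homomorphism into
`End_E(V ⊗_P B)` (`exists_ringHom_forall_apply_eq_map_mulLeft`), `baseAct` in these terms, and
the stability of `V ⊗ Fil^i B` under the diagonal action and under `Fil⁰ B`.

Sources: Fontaine, Astérisque 223, Exp. III §1.5 (functoriality of `D_B` and its filtration);
Brinon–Conrad, *CMI notes*, Prop. 6.3.8; Patrikis, *Variations on a theorem of Tate*, §2.3.1.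

## References

* [FontaineAsterisque223III] J.-M. Fontaine, *Représentations p-adiques semi-stables*,
  Astérisque 223 (1994), Exp. III §1.5.
* [BrinonConrad2009] O. Brinon, B. Conrad, *CMI Summer School notes on p-adic Hodge theory*
  (2009), Prop. 6.3.8.
* [Patrikis2019] S. Patrikis, *Variations on a theorem of Tate*, Mem. AMS 258 (2019), §2.3.1.
-/

noncomputable section

open scoped TensorProduct
open TensorProduct

namespace Literature.NumberTheory.GaloisRepresentations

namespace PeriodRingData

-- Mathlib's own global value of `maxSynthPendingDepth` (the project default `1` makes nested
-- instance problems on `M ⊗[P] 𝔅.B` fail spuriously; see `AdmissibleRestrictOfRingEquiv`).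
set_option maxSynthPendingDepth 3

universe u₁ u₂ v v₁ v₂ w₁ w₂

/-! ### One datum: the multiplication action and the filtration pieces -/

section One

variable {Γ : Type u₁} [Group Γ] [TopologicalSpace Γ] {P : Type v} {F : Type v₁} [Field P]
  [Field F] [Algebra P F]
  {E : Type*} [Field E] [Algebra P E] [TopologicalSpace E]
  {M : Type*} [AddCommGroup M] [Module E M] [Module P M] [IsScalarTower P E M]
  [TopologicalSpace M]
  (𝔅 : PeriodRingData.{u₁, v, v₁, w₁} Γ P F)

omit [TopologicalSpace Γ] [TopologicalSpace E] [TopologicalSpace M] in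
/-- **Multiplication by the right factor as a ring homomorphism into `End_E(M ⊗_P B)`**: for a
ring homomorphism `j : Ω → B` there is `act : Ω →+* End_E(M ⊗_P B)` with
`act a = 1 ⊗ (j a · )` (`act a (m ⊗ b) = m ⊗ (j a * b)`). [folklore] -/
theorem exists_ringHom_forall_apply_eq_map_mulLeft {Ω : Type*} [CommRing Ω] (j : Ω →+* 𝔅.B) :
    ∃ act : Ω →+* Module.End E (M ⊗[P] 𝔅.B), ∀ (a : Ω) (x : M ⊗[P] 𝔅.B),
      act a x = AlgebraTensorModule.map (LinearMap.id : M →ₗ[E] M) (LinearMap.mulLeft P (j a)) x := by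
  refine ⟨{ toFun := fun a => AlgebraTensorModule.map (LinearMap.id : M →ₗ[E] M)
              (LinearMap.mulLeft P (j a))
            map_one' := ?_, map_mul' := ?_, map_zero' := ?_, map_add' := ?_ }, fun a x => rfl⟩
  · refine AlgebraTensorModule.ext fun m b => ?_
    simp only [AlgebraTensorModule.map_tmul, LinearMap.id_coe, id_eq, LinearMap.mulLeft_apply,
      map_one, one_mul, Module.End.one_apply]
  · intro a a'
    refine AlgebraTensorModule.ext fun m b => ?_
    simp only [AlgebraTensorModule.map_tmul, LinearMap.id_coe, id_eq, LinearMap.mulLeft_apply,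
      map_mul, Module.End.mul_apply, mul_assoc]
  · refine AlgebraTensorModule.ext fun m b => ?_
    simp only [AlgebraTensorModule.map_tmul, LinearMap.id_coe, id_eq, LinearMap.mulLeft_apply,
      map_zero, zero_mul, tmul_zero, LinearMap.zero_apply]
  · intro a a'
    refine AlgebraTensorModule.ext fun m b => ?_
    simp only [AlgebraTensorModule.map_tmul, LinearMap.id_coe, id_eq, LinearMap.mulLeft_apply,
      map_add, add_mul, tmul_add, LinearMap.add_apply]

omit [TopologicalSpace Γ] [TopologicalSpace E] [TopologicalSpace M] in
/-- `baseAct f` is multiplication by `algebraMap F B f` on the right factor. [folklore] -/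
theorem baseAct_eq_map_mulLeft (f : F) (x : M ⊗[P] 𝔅.B) :
    𝔅.baseAct E M f x =
      AlgebraTensorModule.map (LinearMap.id : M →ₗ[E] M)
        (LinearMap.mulLeft P (algebraMap F 𝔅.B f)) x := by
  induction x using TensorProduct.induction_on with
  | zero => simp only [map_zero]
  | tmul m b => simp [Algebra.smul_def]
  | add x y hx hy => simp only [map_add, hx, hy]

omit [TopologicalSpace Γ] [TopologicalSpace E] [TopologicalSpace M] in
/-- Pure tensors `m ⊗ b` with `b ∈ Fil^i B` lie in `M ⊗ Fil^i B`. [folklore] -/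
theorem tmul_mem_coeffFilTensor {i : ℤ} (m : M) {b : 𝔅.B} (hb : b ∈ 𝔅.fil i) :
    m ⊗ₜ[P] b ∈ 𝔅.coeffFilTensor E M i :=
  ⟨m ⊗ₜ ⟨b, hb⟩, rfl⟩

omit [TopologicalSpace Γ] [TopologicalSpace E] [TopologicalSpace M] in
/-- Induction principle for `M ⊗ Fil^i B`: it is generated by the `m ⊗ b`, `b ∈ Fil^i B`.
[folklore] -/
theorem coeffFilTensor_induction {i : ℤ} {C : M ⊗[P] 𝔅.B → Prop} (h0 : C 0)
    (htmul : ∀ (m : M) (b : 𝔅.B), b ∈ 𝔅.fil i → C (m ⊗ₜ b))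
    (hadd : ∀ x y, C x → C y → C (x + y)) {x : M ⊗[P] 𝔅.B} (hx : x ∈ 𝔅.coeffFilTensor E M i) :
    C x := by
  obtain ⟨y, rfl⟩ := hx
  induction y using TensorProduct.induction_on with
  | zero => simpa using h0
  | tmul m b => exact htmul m b b.2
  | add y z hy hz => simpa using hadd _ _ hy hz

/-- **`M ⊗ Fil^i B` is stable under the diagonal action** (each `Fil^i B` is `Γ`-stable).
[cite: FontaineAsterisque223III, Exp. III §1.5] -/
theorem coeffTensorRep_mem_coeffFilTensor (ρ : ContinuousRep Γ E M) (σ : Γ) {i : ℤ}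
    {x : M ⊗[P] 𝔅.B} (hx : x ∈ 𝔅.coeffFilTensor E M i) :
    𝔅.coeffTensorRep ρ σ x ∈ 𝔅.coeffFilTensor E M i := by
  refine 𝔅.coeffFilTensor_induction (C := fun x => 𝔅.coeffTensorRep ρ σ x ∈ 𝔅.coeffFilTensor E M i)
    (by simp) (fun m b hb => ?_) (fun x y hx hy => by simpa using add_mem hx hy) hx
  rw [coeffTensorRep_apply_tmul]
  exact 𝔅.tmul_mem_coeffFilTensor _ (𝔅.smul_mem_fil σ i b hb)

omit [TopologicalSpace Γ] [TopologicalSpace E] [TopologicalSpace M] in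
/-- **`M ⊗ Fil^i B` is stable under multiplication by `Fil⁰ B`** (the filtration is
multiplicative). [cite: FontaineAsterisque223III, Exp. III §1.5] -/
theorem map_mulLeft_mem_coeffFilTensor {b₀ : 𝔅.B} (hb₀ : b₀ ∈ 𝔅.fil 0) {i : ℤ}
    {x : M ⊗[P] 𝔅.B} (hx : x ∈ 𝔅.coeffFilTensor E M i) :
    AlgebraTensorModule.map (LinearMap.id : M →ₗ[E] M) (LinearMap.mulLeft P b₀) x ∈
      𝔅.coeffFilTensor E M i := by
  refine 𝔅.coeffFilTensor_induction
    (C := fun x => AlgebraTensorModule.map (LinearMap.id : M →ₗ[E] M) (LinearMap.mulLeft P b₀) x ∈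
      𝔅.coeffFilTensor E M i)
    (by simp) (fun m b hb => ?_) (fun x y hx hy => by simpa using add_mem hx hy) hx
  simp only [AlgebraTensorModule.map_tmul, LinearMap.id_coe, id_eq, LinearMap.mulLeft_apply]
  exact 𝔅.tmul_mem_coeffFilTensor _ (by simpa using 𝔅.mul_mem_fil 0 i b₀ b hb₀ hb)

end One

/-! ### Two data: transport along `Ψ = 1 ⊗ Φ` -/

section Two

variable {Γ₁ : Type u₁} {Γ₂ : Type u₂} [Group Γ₁] [Group Γ₂] [TopologicalSpace Γ₁]
  [TopologicalSpace Γ₂] {P : Type v} {F₁ : Type v₁} {F₂ : Type v₂} [Field P] [Field F₁] [Field F₂]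
  [Algebra P F₁] [Algebra P F₂]
  {E : Type*} [Field E] [Algebra P E] [TopologicalSpace E]
  {M : Type*} [AddCommGroup M] [Module E M] [Module P M] [IsScalarTower P E M]
  [TopologicalSpace M]
  (𝔅₁ : PeriodRingData.{u₁, v, v₁, w₁} Γ₁ P F₁) (𝔅₂ : PeriodRingData.{u₂, v, v₂, w₂} Γ₂ P F₂)
  (ρ₁ : ContinuousRep Γ₁ E M) (ρ₂ : ContinuousRep Γ₂ E M) (r : Γ₂ → Γ₁)
  (hρ : ∀ (τ : Γ₂) (m : M), ρ₂ τ m = ρ₁ (r τ) m)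
  (Φ : 𝔅₁.B ≃+* 𝔅₂.B) (hΦ : ∀ (τ : Γ₂) (b : 𝔅₁.B), Φ (r τ • b) = τ • Φ b)
  (Ψ : M ⊗[P] 𝔅₁.B →ₗ[E] M ⊗[P] 𝔅₂.B) (hΨ : ∀ (m : M) (b : 𝔅₁.B), Ψ (m ⊗ₜ b) = m ⊗ₜ Φ b)

include hΨ

omit [TopologicalSpace Γ₁] [TopologicalSpace Γ₂] [TopologicalSpace E] [TopologicalSpace M] in
/-- **`1 ⊗ Φ` intertwines multiplication by `b` and by `Φ b`.** [folklore] -/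
theorem map_map_mulLeft_eq (b : 𝔅₁.B) (x : M ⊗[P] 𝔅₁.B) :
    Ψ (AlgebraTensorModule.map (LinearMap.id : M →ₗ[E] M) (LinearMap.mulLeft P b) x) =
      AlgebraTensorModule.map (LinearMap.id : M →ₗ[E] M) (LinearMap.mulLeft P (Φ b)) (Ψ x) := by
  induction x using TensorProduct.induction_on with
  | zero => simp only [map_zero]
  | tmul m b' => simp [hΨ, map_mul]
  | add x y hx hy => simp only [map_add, hx, hy]

omit [TopologicalSpace Γ₁] [TopologicalSpace Γ₂] [TopologicalSpace E] [TopologicalSpace M] in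
/-- **`1 ⊗ Φ` maps `M ⊗ Fil^i B₁` into `M ⊗ Fil^i B₂`** when `Φ (Fil^i B₁) ⊆ Fil^i B₂`. [folklore] -/
theorem map_mem_coeffFilTensor {i : ℤ} (hfil : ∀ b : 𝔅₁.B, b ∈ 𝔅₁.fil i → Φ b ∈ 𝔅₂.fil i)
    {x : M ⊗[P] 𝔅₁.B} (hx : x ∈ 𝔅₁.coeffFilTensor E M i) : Ψ x ∈ 𝔅₂.coeffFilTensor E M i := by
  refine 𝔅₁.coeffFilTensor_induction (C := fun x => Ψ x ∈ 𝔅₂.coeffFilTensor E M i)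
    (by simp) (fun m b hb => ?_) (fun x y hx hy => by simpa using add_mem hx hy) hx
  rw [hΨ]
  exact 𝔅₂.tmul_mem_coeffFilTensor _ (hfil b hb)

include hρ hΦ

/-- **`1 ⊗ Φ` intertwines the diagonal actions through `r`.** [cite: FontaineAsterisque223III, Exp. III §1.3] -/
theorem map_coeffTensorRep_eq (τ : Γ₂) (x : M ⊗[P] 𝔅₁.B) :
    Ψ (𝔅₁.coeffTensorRep ρ₁ (r τ) x) = 𝔅₂.coeffTensorRep ρ₂ τ (Ψ x) := by
  induction x using TensorProduct.induction_on with
  | zero => simp only [map_zero]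
  | tmul m b => rw [coeffTensorRep_apply_tmul, hΨ, hΨ, coeffTensorRep_apply_tmul, hΦ, hρ]
  | add x y hx hy => simp only [map_add, hx, hy]

omit hΨ hρ hΦ

/-- **Transport of `Fil^i D_{τ₂}` along `1 ⊗ Φ`.**  Let `Φ : B₁ ≃+* B₂` be `P`-linear,
`r`-equivariant and strictly filtered, and `ρ₂ τ = ρ₁ (r τ)`.  Then for every label
`τ₂ : F₂ → E` and every `i`, `Fil^i D_{τ₂}(ρ₂) ⊆ M ⊗_P B₂` is the image under `1 ⊗ Φ` of
`T ∩ (M ⊗ Fil^i B₁)`, where `T = {y | y is r(Γ₂)-invariant and Φ⁻¹(f) acts on y by τ₂ f, f ∈ F₂}`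
(supplied through its membership condition `hT`); in particular the `E`-dimensions agree.
Fontaine, Exp. III §1.5 (functoriality of `D_B` with its filtration); used for
`HT_{τ''}(V|_{Γ_L}) = HT_{τ''|_K}(V)` (Brinon–Conrad Prop. 6.3.8, Patrikis §2.7.1).
[cite: FontaineAsterisque223III, Exp. III §1.5] [cite: BrinonConrad2009, Prop. 6.3.8] -/
theorem finrank_labelFilD_eq_finrank_inf
    (hρ : ∀ (τ : Γ₂) (m : M), ρ₂ τ m = ρ₁ (r τ) m)
    (Φ : 𝔅₁.B ≃+* 𝔅₂.B) (hΦP : ∀ c : P, Φ (algebraMap P 𝔅₁.B c) = algebraMap P 𝔅₂.B c)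
    (hΦ : ∀ (τ : Γ₂) (b : 𝔅₁.B), Φ (r τ • b) = τ • Φ b)
    (hfil : ∀ (i : ℤ) (b : 𝔅₁.B), b ∈ 𝔅₁.fil i ↔ Φ b ∈ 𝔅₂.fil i)
    (τ₂ : F₂ →+* E) (T : Submodule E (M ⊗[P] 𝔅₁.B))
    (hT : ∀ y, y ∈ T ↔ (∀ τ : Γ₂, 𝔅₁.coeffTensorRep ρ₁ (r τ) y = y) ∧
      ∀ f : F₂, AlgebraTensorModule.map (LinearMap.id : M →ₗ[E] M)
        (LinearMap.mulLeft P (Φ.symm (algebraMap F₂ 𝔅₂.B f))) y = τ₂ f • y)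
    (i : ℤ) :
    Module.finrank E ↥(𝔅₂.labelFilD ρ₂ τ₂ i) =
      Module.finrank E ↥(T ⊓ 𝔅₁.coeffFilTensor E M i) := by
  -- `Ψ = 1 ⊗ Φ`, as a pair of inverse `E`-linear maps `f`, `g`
  obtain ⟨Ψ, hΨ⟩ : ∃ Ψ : M ⊗[P] 𝔅₁.B ≃ₗ[E] M ⊗[P] 𝔅₂.B, ∀ (m : M) (b : 𝔅₁.B),
      Ψ (m ⊗ₜ b) = m ⊗ₜ Φ b :=
    ⟨AlgebraTensorModule.congr (LinearEquiv.refl E M) (AlgEquiv.ofRingEquiv (f := Φ) hΦP).toLinearEquiv,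
      fun m b => by
        rw [AlgebraTensorModule.congr_tmul, LinearEquiv.refl_apply, AlgEquiv.toLinearEquiv_apply,
          AlgEquiv.ofRingEquiv_apply]⟩
  set f : M ⊗[P] 𝔅₁.B →ₗ[E] M ⊗[P] 𝔅₂.B := (Ψ : M ⊗[P] 𝔅₁.B →ₗ[E] M ⊗[P] 𝔅₂.B) with hf_def
  set g : M ⊗[P] 𝔅₂.B →ₗ[E] M ⊗[P] 𝔅₁.B := (Ψ.symm : M ⊗[P] 𝔅₂.B →ₗ[E] M ⊗[P] 𝔅₁.B)
    with hg_def
  have hf : ∀ (m : M) (b : 𝔅₁.B), f (m ⊗ₜ b) = m ⊗ₜ Φ b := fun m b => hΨ m b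
  have hfg : ∀ x, f (g x) = x := fun x => Ψ.apply_symm_apply x
  have hfinj : Function.Injective f := Ψ.injective
  have hg : ∀ (m : M) (b : 𝔅₂.B), g (m ⊗ₜ b) = m ⊗ₜ Φ.symm b := fun m b => by
    apply hfinj
    rw [hfg, hf, RingEquiv.apply_symm_apply]
  -- the key identification
  suffices h : 𝔅₂.labelFilD ρ₂ τ₂ i = (T ⊓ 𝔅₁.coeffFilTensor E M i).map f by
    rw [h]; exact LinearEquiv.finrank_map_eq Ψ _
  ext x
  rw [Submodule.mem_map]
  constructor
  · intro hx
    refine ⟨g x, ?_, hfg x⟩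
    obtain ⟨⟨hxD, hxF⟩, hxfil⟩ := hx
    refine Submodule.mem_inf.2 ⟨(hT _).2 ⟨fun τ => ?_, fun f' => ?_⟩, ?_⟩
    · apply hfinj
      rw [map_coeffTensorRep_eq 𝔅₁ 𝔅₂ ρ₁ ρ₂ r hρ Φ hΦ f hf, hfg]
      exact hxD τ
    · apply hfinj
      rw [map_map_mulLeft_eq 𝔅₁ 𝔅₂ Φ f hf, RingEquiv.apply_symm_apply, hfg, map_smul, hfg,
        ← baseAct_eq_map_mulLeft]
      exact hxF f'
    · exact map_mem_coeffFilTensor 𝔅₂ 𝔅₁ Φ.symm g hg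
        (fun b hb => (hfil i _).2 (by rwa [RingEquiv.apply_symm_apply])) hxfil
  · rintro ⟨y, hy, rfl⟩
    obtain ⟨hyT, hyfil⟩ := Submodule.mem_inf.1 hy
    obtain ⟨hyD, hyF⟩ := (hT y).1 hyT
    refine ⟨⟨fun τ => ?_, fun f' => ?_⟩, ?_⟩
    · show 𝔅₂.coeffTensorRep ρ₂ τ (f y) = f y
      rw [← map_coeffTensorRep_eq 𝔅₁ 𝔅₂ ρ₁ ρ₂ r hρ Φ hΦ f hf, hyD τ]
    · show 𝔅₂.baseAct E M f' (f y) = τ₂ f' • f y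
      rw [baseAct_eq_map_mulLeft,
        show algebraMap F₂ 𝔅₂.B f' = Φ (Φ.symm (algebraMap F₂ 𝔅₂.B f')) from
          (RingEquiv.apply_symm_apply Φ _).symm,
        ← map_map_mulLeft_eq 𝔅₁ 𝔅₂ Φ f hf, hyF f', map_smul]
    · exact map_mem_coeffFilTensor 𝔅₁ 𝔅₂ Φ f hf (fun b hb => (hfil i b).1 hb) hyfil

end Two

end PeriodRingData

end Literature.NumberTheory.GaloisRepresentations

end
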